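import Summits.QuantumFields.QCD.Theorems.SpectralDefectExtinctionWindowExtinctionStubSpreadFromPartsR3

/-!
# Capped S6′: the deep-subcritical fixed-coupling spread from template pairs with a `Q`-dependent depth cap

Sub-goal G10 of line `hermitian-flow-coarea` (crux `Summit.QuantumFields.QCD.Theses.SpectralDefectExtinction.TipPricing`,
item stmt-QuantumFields-8967, lead c2), in the vocabulary LANDED by the sibling seat 8964
(`…WindowExtinctionStubSpreadFromPartsR3.lean`, namespace
`Summit.QuantumFields.QCD.Cruxes.WindowExtinction.FreeVolumeHeavyWitness`: `FixedCouplingIndexSpreadSub`, `Tmpl`,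
`tmplHaar`, `MonotonePair`, `NegCountMeasurable`, `ImplantCostBound`, `DetQuasilocal`, `AntichainWeight`,
`FiberAtomMonotone`, `ActiveCoresAbundant`).

`fixedCouplingIndexSpreadSub_of_cappedTemplatePair` is 8964's landed `stub_spreadFromPartsR3` with its seventh hypothesis
`TemplatePair` (template pairs for EVERY window `hi ≤ 1/4`) weakened to the CAPPED form: for every aspect ratio `Q` a
cap `hT(Q) > 0` and template pairs only for the windows `0 < lo ≤ hi ≤ Q·lo`, `hi ≤ hT(Q)` — which is all the modular
cell–wall template of this line delivers.  The conclusion `FixedCouplingIndexSpreadSub N_f` lets us choose the depth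
constant: `h₀ := min (1/4) hT(Q)` (instead of `1/4`), so that `hi ≤ hi · max β 1 ≤ h₀ ≤ hT(Q)` feeds the capped hypothesis.

Proof: adapted from `stub_spreadFromPartsR3_inlined` (`…WindowExtinctionStubSpreadFromPartsR3Inlined.lean`, 8964 seat
c2) — only the choice of `h₀` and the line applying the template hypothesis change; everything else is their outer
plumbing around the importable per-window theorem `spreadR3_window`, the layer cake
`spread_one_le_integral_abs_of_atom_le` and `spreadR3_negCount_le_card`.
-/

noncomputable section

namespace Summit.QuantumFields.QCD.Cruxes.TipPricing.ModularTemplate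

open scoped BigOperators Topology Classical ENNReal
open Filter MeasureTheory Matrix
open Literature.MathematicalPhysics.QuantumLattice Literature.MathematicalPhysics.QuantumFieldTheory
  Literature.Probability.LatticeModels
open Summit.QuantumFields.QCD.Cruxes.WindowExtinction.FreeVolumeHeavyWitness

/-- **Capped S6′.** The landed S1–S3, S4″ (with S4′), S5a of 8964's line `free-volume-heavy-witness` together with
template pairs for the CAPPED windows (`hi ≤ hT(Q)`, a `Q`-dependent cap) already give the deep-subcritical
fixed-coupling spread `C⁺_sub = FixedCouplingIndexSpreadSub N_f` for every `N_f` (with `h₀(Q) = min (1/4) hT(Q)`). -/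
theorem fixedCouplingIndexSpreadSub_of_cappedTemplatePair :
    NegCountMeasurable → ImplantCostBound → DetQuasilocal → AntichainWeight → FiberAtomMonotone →
      ActiveCoresAbundant →
      (∀ Q : ℕ, ∃ hT : ℝ, 0 < hT ∧ ∀ lo hi : ℝ, 0 < lo → lo ≤ hi → hi ≤ Q * lo → hi ≤ hT →
        ∃ (R : ℕ) (Tp Tm : Set (Tmpl R)), MeasurableSet Tp ∧ MeasurableSet Tm ∧
          tmplHaar R Tp ≠ 0 ∧ tmplHaar R Tm ≠ 0 ∧ ∀ δ : ℝ, lo ≤ δ → δ ≤ hi → MonotonePair R Tp Tm δ) →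
      ∀ Nf : ℕ, FixedCouplingIndexSpreadSub Nf := by
  -- adapted from `stub_spreadFromPartsR3_inlined` (…WindowExtinctionStubSpreadFromPartsR3Inlined, 8964 seat c2),
  -- capped variant: `h₀ := min (1/4) hT(Q)` instead of `1/4`.
  intro hNCM hICB hDQL hAW hFAM hACA hTPc Nf Q
  obtain ⟨hT, hT0, hTP⟩ := hTPc Q
  refine ⟨min (1 / 4) hT, lt_min (by norm_num) hT0, ?_⟩
  intro β lo hi hβ hlo hlohi hQ hsub L₀
  have hhiT : hi ≤ hT := by
    have h1 : (1 : ℝ) ≤ max β 1 := le_max_right _ _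
    have h0 : 0 ≤ hi := hlo.le.trans hlohi
    have h2 : min (1 / 4 : ℝ) hT ≤ hT := min_le_right _ _
    nlinarith
  obtain ⟨R, Tp, Tm, hTp, hTm, hTp0, hTm0, hMP⟩ := hTP lo hi hlo hlohi hQ hhiT
  obtain ⟨A, B, hAB⟩ := hICB Nf R lo hi hlo hlohi
  obtain ⟨C₃, κ, hκ, hQL⟩ := hDQL Nf R lo hi hlo hlohi
  obtain ⟨L', hL₀, hRL, hwin⟩ :=
    spreadR3_window hFAM hACA hAW hTp hTm hTp0 hTm0 hβ hlo hlohi hκ hAB hQL L₀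
  refine ⟨L', hL₀, fun δ hδ1 hδ2 μ hμ => ?_⟩
  have hμpos : ∀ f, 0 < μ f := fun f => hlo.trans_le (hμ f).1
  -- the deep index: measurable, bounded, strictly monotone under `Tm → Tp` swaps
  set X : GaugeConfig 4 (2 * L' + 1) SU3 → ℤ := fun U => deepIndex L' U δ with hX
  have hXm : Measurable X :=
    (measurable_from_top (f := fun k : ℕ => (k : ℤ) - 6 * (2 * (L' : ℤ) + 1) ^ 4)).comp
      (hNCM (2 * L' + 1) (-δ))
  have hmono : ∀ (c : Fin 4 → ℤ) (U U' : GaugeConfig 4 (2 * L' + 1) SU3),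
      (∀ e, (¬ ∃ y : ↥(box 4 R), Torus.proj (2 * L' + 1) (c + (y : Fin 4 → ℤ)) = e.1) → U' e = U e) →
      (fun yi : ↥(box 4 R) × Fin 4 => U (Torus.proj (2 * L' + 1) (c + (yi.1 : Fin 4 → ℤ)), yi.2)) ∈ Tm →
      (fun yi : ↥(box 4 R) × Fin 4 => U' (Torus.proj (2 * L' + 1) (c + (yi.1 : Fin 4 → ℤ)), yi.2)) ∈ Tp →
      X U + 1 ≤ X U' := by
    intro c U U' hagree hm hp
    have h := hMP δ hδ1 hδ2 (2 * L' + 1) hRL c U U' hagree hm hp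
    have h' : (negCount U (-δ) : ℤ) + 1 ≤ negCount U' (-δ) := by exact_mod_cast h
    simp only [hX, deepIndex]
    linarith
  have hatom : ∀ j : ℤ, qcdLatticeMeasure (2 * L' + 1) β μ
      {U : GaugeConfig 4 (2 * L' + 1) SU3 | X U = j} ≤ 4⁻¹ :=
    hwin μ hμ hXm hmono
  -- the phase-quenched measure is a probability measure (`det D_W(μ) ≠ 0` for `μ > 0`)
  have hdet : ∃ U₀ : GaugeConfig 4 (2 * L' + 1) SU3, (diracMatrix U₀ μ).det ≠ 0 := by
    refine ⟨fun _ => 1, ?_⟩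
    rw [det_diracMatrix]
    exact Finset.prod_ne_zero_iff.2 fun f _ =>
      wilsonDirac_det_ne_zero_of_pos (fundamentalRep (Fin 3)) (fun g => fundamentalRep_mem_unitaryGroup g)
        _ (hμpos f)
  haveI : IsProbabilityMeasure (qcdLatticeMeasure (2 * L' + 1) β μ) :=
    isProbabilityMeasure_qcdLatticeMeasure β μ (integral_norm_det_diracMatrix_pos_of_exists β μ hdet)
  -- integrability of the (bounded) index and the layer cake
  have hXr : Measurable fun U : GaugeConfig 4 (2 * L' + 1) SU3 => (X U : ℝ) :=
    (measurable_from_top (f := (Int.cast : ℤ → ℝ))).comp hXm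
  have hbound : ∀ U : GaugeConfig 4 (2 * L' + 1) SU3,
      |(X U : ℝ)| ≤ Fintype.card (TorusSite 4 (2 * L' + 1) × Fin 3 × Fin 4) + 6 * (2 * (L' : ℝ) + 1) ^ 4 := by
    intro U
    have hneg : (negCount U (-δ) : ℝ) ≤ Fintype.card (TorusSite 4 (2 * L' + 1) × Fin 3 × Fin 4) :=
      spreadR3_negCount_le_card U (-δ)
    have h0 : (0 : ℝ) ≤ negCount U (-δ) := Nat.cast_nonneg _
    have hc : (0 : ℝ) ≤ 6 * (2 * (L' : ℝ) + 1) ^ 4 := by positivity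
    have hcast : (X U : ℝ) = (negCount U (-δ) : ℝ) - 6 * (2 * (L' : ℝ) + 1) ^ 4 := by
      simp [hX, deepIndex]
    rw [hcast, abs_le]
    constructor <;> linarith
  have hint : Integrable (fun U : GaugeConfig 4 (2 * L' + 1) SU3 => (X U : ℝ))
      (qcdLatticeMeasure (2 * L' + 1) β μ) :=
    Integrable.of_bound hXr.aestronglyMeasurable _
      (Eventually.of_forall fun U => by rw [Real.norm_eq_abs]; exact hbound U)
  have h1 := spread_one_le_integral_abs_of_atom_le (qcdLatticeMeasure (2 * L' + 1) β μ) hXm hint hatom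
  show 1 ≤ qcdPhaseQuenchedExpect β (2 * L' + 1) μ fun U => |(X U : ℝ)|
  rw [qcdPhaseQuenchedExpect_eq_integral_qcdLatticeMeasure]
  exact h1

end Summit.QuantumFields.QCD.Cruxes.TipPricing.ModularTemplate

end
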